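import Summits.AtomisticToContinuum.Crystallization.Theses.IsometryAtoms
import Summits.AtomisticToContinuum.Crystallization.Theorems.MinimisingLawsHaveAtoms.Negative.DiffuseFamilyLaws
import Summits.AtomisticToContinuum.Crystallization.Theorems.MinimisingLawsHaveAtoms.Negative.DilatedLawEnergy
import Summits.AtomisticToContinuum.Crystallization.Theorems.LayeredLawsSelectHcp.Negative.PeriodicEnergy

/-!
# Negative knowledge for crux `MinimisingLawsHaveAtoms` (stmt-AtomisticToContinuum-15776), XIV:
# ISOLATION IS NECESSARY — a continuum of pairwise non-isometric optimal periodic configurations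
# refutes the crux

Standing crux disprover `cdisprove-stmt-AtomisticToContinuum-15776`,
`--supports stmt-AtomisticToContinuum-15776`.

Both registered lines through this crux carry an ISOLATION stub (`birth` stub 3 =
`perron_transfer` stub 4: "optimal periodic point sets are countably many modulo isometry").  This
file certifies that isolation is NECESSARY, in the following precise form (the diffuse-family
machine of Part II, `DiffuseFamilyLaws`, extended from single configurations to the finite uniform
ROOT MIXTURES that Palm laws of multi-lattices are):

* `exists_diffuse_law_of_mixtureFamily` — a continuous one-parameter family
  `V : Fin (n+1) → ℝ → RootedHardCoreConfig ℝ³ δ` whose uniform mixtures `(n+1)⁻¹ ∑ᵢ δ_{count|Vᵢ t}`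
  satisfy the Mecke identity for each `t`, have mean root energy `≤ e` for `t ∈ [0,1]`, and whose
  members are separated across parameters by an isometry invariant, yields a law of the frame
  (probability, a.s. `δ`-hard-core, point-stationary) with `E[h] ≤ e` charging NO rooted isometry
  class;
* `minimisingLawsHaveAtoms_false_of_optimalPeriodicFamily` — **if there is a one-parameter family
  `t ↦ Q t` of `δ`-separated periodic configurations of `ℝ³`, optimal (`e(Q t) ≤ e*`) for
  `t ∈ [0,1]`, continuous in the local topology seen from continuously enumerated motif points, and
  pairwise non-isometric (separated by an isometry invariant of the point set), then
  `MinimisingLawsHaveAtoms` is FALSE** — the `t`-mixture of the Palm laws `palmLaw (Q t)`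
  (`PeriodicPalmLaw`, `PeriodicEnergy.meanRootEnergy_palmLaw`) is a diffuse minimising law.
Contrapositive for the provers: the crux IMPLIES that optimal periodic configurations admit no such
continuous non-isometric deformation (no elastic / phason zero mode of the unknown optimum at the
level of exact energy) — any proof of purity proves this rigidity on the way.  All `[folklore]`.
-/

noncomputable section

namespace Summit.AtomisticToContinuum.Crystallization.Theorems.MinimisingLawsHaveAtoms.Negative.IsolationNecessary

open MeasureTheory Set Filter Metric Function
open scoped ENNReal Topology
open Literature.MathematicalPhysics.StatisticalMechanics Literature.Probability.Process
open Literature.Probability.Process.LocalConfig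
open Summit.AtomisticToContinuum.Crystallization.Theses.IsometryAtoms (MinimisingLawsHaveAtoms)
open Summit.AtomisticToContinuum.Crystallization.Theorems.ChargedEnergyGapNegative (eStar)
open Summit.AtomisticToContinuum.Crystallization.Theorems.BenjaminiSchrammLimit
  (measurableEmbedding_toMeasure continuous_integral_lennardJones_toMeasure)
open Summit.AtomisticToContinuum.Crystallization.Theorems.LayeredLawsSelectHcp.Negative.DiracLaws
  (meanRootEnergy)
open Summit.AtomisticToContinuum.Crystallization.Theorems.LayeredLawsSelectHcp.Negative.PeriodicPalmLaw
open Summit.AtomisticToContinuum.Crystallization.Theorems.LayeredLawsSelectHcp.Negative.PeriodicEnergy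
  (meanRootEnergy_palmLaw)
open Summit.AtomisticToContinuum.Crystallization.Theorems.MinimisingLawsHaveAtoms.Negative.DiffuseFamilyLaws
open Summit.AtomisticToContinuum.Crystallization.Theorems.MinimisingLawsHaveAtoms.Negative.DilatedLawMecke
open Summit.AtomisticToContinuum.Crystallization.Theorems.MinimisingLawsHaveAtoms.Negative.DilatedLawEnergy

/-! ## §1 Finite uniform root mixtures of continuous families -/

section Mixture

variable {δ : ℝ} [Fact (0 < δ)] {n : ℕ}

/-- **The diffuse-family machine for finite root mixtures.** A continuous family
`V : Fin (n+1) → ℝ → RootedHardCoreConfig ℝ³ δ` whose uniform mixtures satisfy the Mecke identity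
parameter-wise, of mean root energy `≤ e` on `[0,1]`, separated across parameters by an isometry
invariant `ι`, gives a law of the frame with `E[h] ≤ e` charging no rooted isometry class: the law
`(n+1)⁻¹ ∑ᵢ (Leb|[0,1]).map (t ↦ count|Vᵢ t)`. [folklore] -/
theorem exists_diffuse_law_of_mixtureFamily
    (V : Fin (n + 1) → ℝ → RootedHardCoreConfig (EuclideanSpace ℝ (Fin 3)) δ)
    (hV : ∀ i, Continuous (V i))
    {β : Type*} (ι : Set (EuclideanSpace ℝ (Fin 3)) → β)
    (hι : ∀ φ : EuclideanSpace ℝ (Fin 3) → EuclideanSpace ℝ (Fin 3), Isometry φ →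
      ∀ X : Set (EuclideanSpace ℝ (Fin 3)), ι (φ '' X) = ι X)
    (hinj : ∀ i, Injective fun t =>
      ι (((V i t).1 : LocalConfig (EuclideanSpace ℝ (Fin 3))) : Set (EuclideanSpace ℝ (Fin 3))))
    (hMecke : ∀ t, ∀ g : Measure (EuclideanSpace ℝ (Fin 3)) → EuclideanSpace ℝ (Fin 3) → ℝ≥0∞,
      Measurable (uncurry g) →
      ∑ i, ∫⁻ y, g ((V i t).1 : LocalConfig (EuclideanSpace ℝ (Fin 3))).toMeasure y
          ∂((V i t).1 : LocalConfig (EuclideanSpace ℝ (Fin 3))).toMeasure =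
        ∑ i, ∫⁻ y, g ((((V i t).1 : LocalConfig (EuclideanSpace ℝ (Fin 3))).toMeasure).map
            fun z => z - y) (-y) ∂((V i t).1 : LocalConfig (EuclideanSpace ℝ (Fin 3))).toMeasure)
    {e : ℝ} (hE : ∀ t ∈ Icc (0 : ℝ) 1,
      ∑ i, rootEnergy lennardJones (((V i t).1 : LocalConfig (EuclideanSpace ℝ (Fin 3))).toMeasure) ≤
        ((n : ℝ) + 1) * e) :
    ∃ P : Measure (Measure (EuclideanSpace ℝ (Fin 3))),
      IsProbabilityMeasure P ∧ (∀ᵐ μ ∂P, IsRootedHardCore δ μ) ∧ IsPointStationaryLaw P ∧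
      (∫ μ, rootEnergy lennardJones μ ∂P) ≤ e ∧
      ∀ Y : Set (EuclideanSpace ℝ (Fin 3)), P {μ | ∃ A : EuclideanSpace ℝ (Fin 3) →ₗᵢ[ℝ]
        EuclideanSpace ℝ (Fin 3), ∃ q ∈ Y, μ = (Measure.count : Measure
          (EuclideanSpace ℝ (Fin 3))).restrict ((fun s => A (s - q)) '' Y)} = 0 := by
  have hδ : 0 < δ := Fact.out
  -- the parameter law: Lebesgue on `[0,1]`
  set μ0 : Measure ℝ := (volume : Measure ℝ).restrict (Icc 0 1) with hμ0
  haveI hμ0P : IsProbabilityMeasure μ0 :=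
    ⟨by rw [hμ0, Measure.restrict_apply_univ, Real.volume_Icc, sub_zero, ENNReal.ofReal_one]⟩
  -- each member family is a measurable embedding into `Measure ℝ³`
  have hVinj : ∀ i, Injective (V i) := fun i s t hst => hinj i (by simp only [hst])
  have hEmb : ∀ i, MeasurableEmbedding fun t =>
      ((V i t).1 : LocalConfig (EuclideanSpace ℝ (Fin 3))).toMeasure :=
    fun i => measurableEmbedding_count_restrict_of_continuous (V i) (hV i) (hVinj i)
  have hn0 : (((n + 1 : ℕ)) : ℝ≥0∞) ≠ 0 := by exact_mod_cast Nat.succ_ne_zero n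
  have hnt : (((n + 1 : ℕ)) : ℝ≥0∞) ≠ ⊤ := ENNReal.natCast_ne_top _
  refine ⟨(((n + 1 : ℕ)) : ℝ≥0∞)⁻¹ • ∑ i : Fin (n + 1), μ0.map fun t =>
      ((V i t).1 : LocalConfig (EuclideanSpace ℝ (Fin 3))).toMeasure, ?_, ?_, ?_, ?_, ?_⟩
  · -- probability
    refine ⟨?_⟩
    rw [Measure.smul_apply, Measure.coe_finsetSum, Finset.sum_apply, smul_eq_mul]
    have h1 : ∀ i : Fin (n + 1), (μ0.map fun t =>
        ((V i t).1 : LocalConfig (EuclideanSpace ℝ (Fin 3))).toMeasure) univ = 1 := fun i => by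
      rw [(hEmb i).map_apply, preimage_univ, measure_univ]
    simp only [h1, Finset.sum_const, Finset.card_univ, Fintype.card_fin, nsmul_eq_mul, mul_one]
    exact ENNReal.inv_mul_cancel hn0 hnt
  · -- a.s. hard core
    refine Measure.ae_smul_measure ?_ _
    rw [ae_iff, Measure.coe_finsetSum, Finset.sum_apply]
    refine Finset.sum_eq_zero fun i _ => ?_
    exact ae_iff.1 (ae_isRootedHardCore_map_family (ν := μ0) (hEmb i)
      fun t => (isRootedHardCore_toMeasure_iff δ _).2 (V i t).2)
  · -- Mecke identity: push to the parameter, swap the finite sum and the integral, use `hMecke`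
    intro g hg
    rw [lintegral_smul_measure, lintegral_smul_measure, lintegral_finsetSum_measure,
      lintegral_finsetSum_measure]
    congr 1
    have h1 : ∑ i, ∫⁻ μ, (∫⁻ y, g μ y ∂μ) ∂(μ0.map fun t =>
        ((V i t).1 : LocalConfig (EuclideanSpace ℝ (Fin 3))).toMeasure) =
        ∑ i, ∫⁻ t, (∫⁻ y, g ((V i t).1 : LocalConfig (EuclideanSpace ℝ (Fin 3))).toMeasure y
          ∂((V i t).1 : LocalConfig (EuclideanSpace ℝ (Fin 3))).toMeasure) ∂μ0 :=
      Finset.sum_congr rfl fun i _ => (hEmb i).lintegral_map _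
    have h2 : ∑ i, ∫⁻ μ, (∫⁻ y, g (μ.map fun z => z - y) (-y) ∂μ) ∂(μ0.map fun t =>
        ((V i t).1 : LocalConfig (EuclideanSpace ℝ (Fin 3))).toMeasure) =
        ∑ i, ∫⁻ t, (∫⁻ y, g ((((V i t).1 : LocalConfig (EuclideanSpace ℝ (Fin 3))).toMeasure).map
          fun z => z - y) (-y) ∂((V i t).1 : LocalConfig (EuclideanSpace ℝ (Fin 3))).toMeasure) ∂μ0 :=
      Finset.sum_congr rfl fun i _ => (hEmb i).lintegral_map _
    rw [h1, h2, ← lintegral_finsetSum (s := Finset.univ)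
        (f := fun i t => ∫⁻ y, g ((V i t).1 : LocalConfig (EuclideanSpace ℝ (Fin 3))).toMeasure y
          ∂((V i t).1 : LocalConfig (EuclideanSpace ℝ (Fin 3))).toMeasure)
        fun i _ => (measurable_lintegral_toMeasure hg).comp (hV i).measurable,
      ← lintegral_finsetSum (s := Finset.univ)
        (f := fun i t => ∫⁻ y, g ((((V i t).1 : LocalConfig (EuclideanSpace ℝ (Fin 3))).toMeasure).map
          fun z => z - y) (-y) ∂((V i t).1 : LocalConfig (EuclideanSpace ℝ (Fin 3))).toMeasure)
        fun i _ => (measurable_lintegral_shift_toMeasure hg).comp (hV i).measurable]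
    exact lintegral_congr fun t => hMecke t g hg
  · -- energy
    have hcontH : Continuous fun S : RootedHardCoreConfig (EuclideanSpace ℝ (Fin 3)) δ =>
        rootEnergy lennardJones ((S.1 : LocalConfig (EuclideanSpace ℝ (Fin 3))).toMeasure) := by
      simp only [rootEnergy_def]
      exact (continuous_integral_lennardJones_toMeasure hδ).div_const 2
    obtain ⟨C, hC⟩ := exists_bound_rootEnergy_toMeasure (δ := δ)
    have hInt : ∀ i : Fin (n + 1), Integrable (fun t => rootEnergy lennardJones
        (((V i t).1 : LocalConfig (EuclideanSpace ℝ (Fin 3))).toMeasure)) μ0 := fun i =>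
      (integrable_const C).mono' (hcontH.comp (hV i)).measurable.aestronglyMeasurable
        (Eventually.of_forall fun t => by simpa [Real.norm_eq_abs] using hC (V i t))
    have hInt' : ∀ i ∈ (Finset.univ : Finset (Fin (n + 1))), Integrable (rootEnergy lennardJones)
        (μ0.map fun t => ((V i t).1 : LocalConfig (EuclideanSpace ℝ (Fin 3))).toMeasure) :=
      fun i _ => ((hEmb i).integrable_map_iff).2 (hInt i)
    rw [integral_smul_measure, integral_finsetSum_measure hInt', ENNReal.toReal_inv,
      ENNReal.toReal_natCast, smul_eq_mul]
    have h3 : ∑ i, ∫ μ, rootEnergy lennardJones μ ∂(μ0.map fun t =>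
        ((V i t).1 : LocalConfig (EuclideanSpace ℝ (Fin 3))).toMeasure) =
        ∫ t, ∑ i, rootEnergy lennardJones
          (((V i t).1 : LocalConfig (EuclideanSpace ℝ (Fin 3))).toMeasure) ∂μ0 := by
      rw [integral_finsetSum _ fun i _ => hInt i]
      exact Finset.sum_congr rfl fun i _ => (hEmb i).integral_map _
    have h4 : (∫ t, ∑ i, rootEnergy lennardJones
        (((V i t).1 : LocalConfig (EuclideanSpace ℝ (Fin 3))).toMeasure) ∂μ0) ≤ ((n : ℝ) + 1) * e := by
      have hle : (fun t => ∑ i, rootEnergy lennardJones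
          (((V i t).1 : LocalConfig (EuclideanSpace ℝ (Fin 3))).toMeasure)) ≤ᵐ[μ0]
          fun _ => ((n : ℝ) + 1) * e := by
        rw [hμ0]
        filter_upwards [ae_restrict_mem measurableSet_Icc] with t ht
        exact hE t ht
      calc (∫ t, ∑ i, rootEnergy lennardJones
            (((V i t).1 : LocalConfig (EuclideanSpace ℝ (Fin 3))).toMeasure) ∂μ0)
          ≤ ∫ _t, ((n : ℝ) + 1) * e ∂μ0 :=
            integral_mono_ae (integrable_finsetSum _ fun i _ => hInt i) (integrable_const _) hle
        _ = ((n : ℝ) + 1) * e := by rw [integral_const, probReal_univ, one_smul]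
    rw [h3]
    have hn : ((n : ℝ) + 1) ≠ 0 := by positivity
    calc (((n + 1 : ℕ) : ℝ))⁻¹ * ∫ t, ∑ i, rootEnergy lennardJones
          (((V i t).1 : LocalConfig (EuclideanSpace ℝ (Fin 3))).toMeasure) ∂μ0
        ≤ (((n + 1 : ℕ) : ℝ))⁻¹ * (((n : ℝ) + 1) * e) :=
          mul_le_mul_of_nonneg_left h4 (by positivity)
      _ = e := by push_cast; rw [← mul_assoc, inv_mul_cancel₀ hn, one_mul]
  · -- no rooted isometry class is charged
    intro Y
    rw [Measure.smul_apply, Measure.coe_finsetSum, Finset.sum_apply, smul_eq_mul]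
    refine mul_eq_zero_of_right _ (Finset.sum_eq_zero fun i _ => ?_)
    exact map_family_rootedClass_eq_zero (ν := μ0) (hEmb i) ι hι (hinj i) Y

end Mixture

/-! ## §2 Continua of optimal periodic configurations refute the crux -/

/-- **ISOLATION IS NECESSARY.** If `t ↦ Q t` is a one-parameter family of `δ`-separated periodic
configurations of `ℝ³`, optimal (`e(Q t) ≤ e*`) for `t ∈ [0,1]`, with continuously enumerated
motifs `(Q t).motif = {x₀ t, …, xₙ t}` along which the rooted views `Q t − xᵢ t` move continuously
in the local topology, and pairwise non-isometric (an isometry invariant `ι` of point sets separates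
the parameters), then `MinimisingLawsHaveAtoms` is FALSE: the mixture over `t` of the Palm laws
`palmLaw (Q t)` is a minimising point-stationary hard-core law charging no rooted isometry class.
[folklore] -/
theorem minimisingLawsHaveAtoms_false_of_optimalPeriodicFamily {δ : ℝ} (hδ : 0 < δ) {n : ℕ}
    (Q : ℝ → PeriodicConfiguration 3)
    (hsep : ∀ t, ∀ p ∈ (Q t).points, ∀ q ∈ (Q t).points, p ≠ q → δ ≤ dist p q)
    (hopt : ∀ t ∈ Icc (0 : ℝ) 1, (Q t).energyPerParticle lennardJones ≤ eStar)
    (x : Fin (n + 1) → ℝ → EuclideanSpace ℝ (Fin 3))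
    (hx : ∀ t, (Q t).motif = Finset.univ.image fun i => x i t)
    (hxinj : ∀ t, Injective fun i => x i t)
    (hcont : ∀ i, Continuous fun t =>
      (LocalConfig.mk (view (Q t) (x i t)) : LocalConfig (EuclideanSpace ℝ (Fin 3))))
    {β : Type*} (ι : Set (EuclideanSpace ℝ (Fin 3)) → β)
    (hι : ∀ φ : EuclideanSpace ℝ (Fin 3) → EuclideanSpace ℝ (Fin 3), Isometry φ →
      ∀ X : Set (EuclideanSpace ℝ (Fin 3)), ι (φ '' X) = ι X)
    (hinj : Injective fun t => ι (Q t).points) :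
    ¬ MinimisingLawsHaveAtoms := by
  haveI : Fact (0 < δ) := ⟨hδ⟩
  have hxm : ∀ i t, x i t ∈ (Q t).motif := fun i t => by
    rw [hx t]
    exact Finset.mem_image_of_mem _ (Finset.mem_univ i)
  -- the rooted views as a continuous family of rooted hard-core configurations
  set V : Fin (n + 1) → ℝ → RootedHardCoreConfig (EuclideanSpace ℝ (Fin 3)) δ := fun i t =>
    ⟨LocalConfig.mk (view (Q t) (x i t)), zero_mem_view (Q t) ((Q t).mem_points_of_mem_motif (hxm i t)),
      view_separated (Q t) (hsep t) (x i t)⟩ with hVdef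
  have hV : ∀ i, Continuous (V i) := fun i => (hcont i).subtype_mk _
  have hview : ∀ i t, (((V i t).1 : LocalConfig (EuclideanSpace ℝ (Fin 3))).toMeasure) =
      viewMeasure (Q t) (x i t) := fun _ _ => rfl
  have hcarrier : ∀ i t, (((V i t).1 : LocalConfig (EuclideanSpace ℝ (Fin 3))) :
      Set (EuclideanSpace ℝ (Fin 3))) = view (Q t) (x i t) := fun _ _ => rfl
  -- the invariant of a view is the invariant of the point set
  have hιview : ∀ i t, ι (view (Q t) (x i t)) = ι (Q t).points := fun i t =>
    hι _ (Isometry.of_dist_eq fun a b => dist_sub_right a b (x i t)) _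
  have hinj' : ∀ i, Injective fun t =>
      ι (((V i t).1 : LocalConfig (EuclideanSpace ℝ (Fin 3))) : Set (EuclideanSpace ℝ (Fin 3))) := by
    intro i s t hst
    simp only [hcarrier, hιview] at hst
    exact hinj hst
  have hcard : ∀ t, (Q t).motif.card = n + 1 := fun t => by
    rw [hx t, Finset.card_image_of_injective _ (hxinj t), Finset.card_univ, Fintype.card_fin]
  -- Mecke parameter-wise: the Palm law of `Q t` is point-stationary
  have hMecke : ∀ t, ∀ g : Measure (EuclideanSpace ℝ (Fin 3)) → EuclideanSpace ℝ (Fin 3) → ℝ≥0∞,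
      Measurable (uncurry g) →
      ∑ i, ∫⁻ y, g ((V i t).1 : LocalConfig (EuclideanSpace ℝ (Fin 3))).toMeasure y
          ∂((V i t).1 : LocalConfig (EuclideanSpace ℝ (Fin 3))).toMeasure =
        ∑ i, ∫⁻ y, g ((((V i t).1 : LocalConfig (EuclideanSpace ℝ (Fin 3))).toMeasure).map
            fun z => z - y) (-y) ∂((V i t).1 : LocalConfig (EuclideanSpace ℝ (Fin 3))).toMeasure := by
    intro t g hg
    have hM := pointStationary_palmLaw (Q t) g hg
    rw [lintegral_palmLaw, lintegral_palmLaw,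
      ENNReal.mul_right_inj (ENNReal.inv_ne_zero.2 (ENNReal.natCast_ne_top _))
        (ENNReal.inv_ne_top.2 (card_ne_zero (Q t))),
      hx t, Finset.sum_image fun a _ b _ h => hxinj t h,
      Finset.sum_image fun a _ b _ h => hxinj t h] at hM
    simp only [hview]
    exact hM
  -- energy parameter-wise: `E_{palmLaw (Q t)}[h] = e(Q t) ≤ e*`
  have hE : ∀ t ∈ Icc (0 : ℝ) 1,
      ∑ i, rootEnergy lennardJones (((V i t).1 : LocalConfig (EuclideanSpace ℝ (Fin 3))).toMeasure) ≤
        ((n : ℝ) + 1) * eStar := by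
    intro t ht
    have hm := meanRootEnergy_palmLaw (Q t)
    rw [meanRootEnergy, integral_palmLaw, hx t, Finset.sum_image fun a _ b _ h => hxinj t h] at hm
    rw [← hx t, hcard t] at hm
    push_cast at hm
    have hn : ((n : ℝ) + 1) ≠ 0 := by positivity
    have hsum : ∑ i, rootEnergy lennardJones
        (((V i t).1 : LocalConfig (EuclideanSpace ℝ (Fin 3))).toMeasure) =
        ((n : ℝ) + 1) * (Q t).energyPerParticle lennardJones := by
      simp only [hview, rootEnergy_def]
      rw [← hm, ← mul_assoc, mul_inv_cancel₀ hn, one_mul]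
    rw [hsum]
    exact mul_le_mul_of_nonneg_left (hopt t ht) (by positivity)
  obtain ⟨P, hP, hhc, hst, hEP, hdiff⟩ :=
    exists_diffuse_law_of_mixtureFamily V hV ι hι hinj' hMecke hE
  intro H
  obtain ⟨Y, hY⟩ := H δ hδ P hP hhc hst hEP
  exact hY.ne' (hdiff Y)

end Summit.AtomisticToContinuum.Crystallization.Theorems.MinimisingLawsHaveAtoms.Negative.IsolationNecessary

end
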